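import Summits.ResolutionOfSingularities.ResolutionOfSingularities.Theorems.StallVertexCarry
import Summits.ResolutionOfSingularities.ResolutionOfSingularities.Theorems.StallVertexLines
import HarnessLib

/-!
# StallVertexOldLetter — decomp-res node «StallVertex» (lens-5 g20 rev 5), add-on tree file 11 of the node

Content VERBATIM from the decomp-res lens-5 g20 file `HOME/decomp-res-lens-5/g20/StallVertex.lean` rev 5 (pin
5d7e6b95, 3 024 l; rev 5 SUPERSEDES rev 4 74ef32c0
and rev 3 549891b7 as landing source — insertions only, all earlier statements byte-identical; HOME =
run/shared/lean/pub/decomp-res).  The rev-0/1/2 sections are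
ALREADY in the tree (`StallVertexForms` / `Kernels` / `Walk` / `Classes` / `Clean` / `Rigid` / `Lines` /
`RigidClasses` / `MaxContactCutStallVertex`, writer g7);
these add-on files carry ONLY the declarations NEW in rev 3 / rev 4 / rev 5.  Critic: CRITIC-LEDGER rows 142c (rev
3: the old-letter law, CLEARED 2026-08-30T21:45:00Z),
142d (rev 4: the general carried-line law + line dichotomy, DECIDED +1, 22:09:45Z), 142e (rev 5: the turn law,
booked toward (S), 22:25:58Z) — landing orders INBOX
:362 / :396 / :429 (2).  Landed by decomp-res writer g8 as `StallVertexCarry` (§1d–§1e), `StallVertexOldLetter`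
(§1g + §3d–§3e), `StallVertexLineTurn` (§3f–§3g),
`StallVertexLetterClasses` (§4d–§4e classes and exact re-locations) and the wiring file
`MaxContactCutStallVertexEvents` (§4f classes + every new `closes_…` /
`defectWalksDeep_iff_…` BY NAME on `MaxContactCut.DefectWalksDeep`).  All `--supports
stmt-ResolutionOfSingularities-31770`.  Every file of the node is in the
Theses cone (the lens imports the in-cone `DifferentialShade`), so the located residual is booked on the route by
RE-LOCATING the existing aside 28122
`CFNoSkewJointTailsDeep` to `StallVertex.NoStraightEventFreeSkewStalledTailsDeep` (EXACT, hypothesis-free chain skew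
↔ vertexBound ↔ rigid ↔ lineFree ↔ letterFree ↔
eventFree ↔ straight: `skew_iff_straight`) — one aside, not two (critic: «ONE aside … SUPERSEDING the rev-4
aside; nothing else»).

§1g (rev 5, `section Algebra`): letters of a dehomogenised cone, one-letter initial forms, unit factors
(`vars_dehom_subset`, `vars_homogeneousComponent_subset`,
`homogeneousComponent_eq_monomial_of_vars_subset`, `homogeneousComponent_mul_of_ordZero_eq`, `dehom_X_of_ne`); §3d
(rev 3, `section Walk`) THE ON-PLANE LAW ALONG
THE WALK `eval_direction_eq_zero_of_vertexLawAt`; §3e (rev 3) THE OLD-LETTER LAW `oldLetter_step`,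
`planar_of_oldLetter` (+ `sum_C_single_mul_X`,
`monomial_mul_C_mul_X_pow`).  PROVED, 0 sorry.  Imports `StallVertexCarry` and the landed `StallVertexLines`.

[WRITER NOTE (decomp-res writer g8): file split only; namespace, opens, section variables and every declaration
exactly as in the lens (global `set_option` dropped; the lens's `set_option maxHeartbeats … in` on `turn_monomial` kept).]

(Sources: KawanoueMatsuki2016 Prop. 4 (2), §4.1; Hauser2010; HauserPerlega2024; Moh1987; CossartPiltant2008;
Giraud1975; Hironaka1964; ZariskiSamuelII Ch. VIII §2.)
-/

noncomputable section

open MvPolynomial Finset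
open Literature.AlgebraicGeometry.Resolution
open Literature.AlgebraicGeometry.Resolution.Hauser2010
open Literature.AlgebraicGeometry.Resolution.HauserPerlega2024
open Literature.Barriers.ResolutionOfSingularities
open Literature.AlgebraicGeometry.Resolution.PointBlowup
open Summit.ResolutionOfSingularities.ResolutionOfSingularities.Theses
open Summit.ResolutionOfSingularities.ResolutionOfSingularities.Theorems.TightDefectClasses
open Summit.ResolutionOfSingularities.ResolutionOfSingularities.Theorems.ProximityCut
open Summit.ResolutionOfSingularities.ResolutionOfSingularities.Theorems.ExitLaw
open Summit.ResolutionOfSingularities.ResolutionOfSingularities.Theorems.DifferentialShade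

namespace Summit.ResolutionOfSingularities.ResolutionOfSingularities.Theorems.StallVertex

section Algebra

variable {σ : Type*} {K : Type*} [Field K] [Fintype σ] [DecidableEq σ]

/-! ### §1g Letters of a dehomogenised cone, one-letter initial forms, unit factors (the algebra of the TURN LAW) -/

omit [Fintype σ] in
/-- Dehomogenising at `u_j` and translating creates no letter and kills `u_j`: `vars (dehom_j P) ⊆ vars P ∖ {j}`.
[folklore] -/
theorem vars_dehom_subset (j : σ) (b : σ → K) (P : MvPolynomial σ K) : (dehom j b P).vars ⊆ P.vars.erase j := by
  classical
  intro i hi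
  unfold dehom PointBlowup.translate at hi
  rw [MvPolynomial.aeval_eq_bind₁, MvPolynomial.aeval_eq_bind₁] at hi
  obtain ⟨i₁, hi₁, hi₁'⟩ := Finset.mem_biUnion.mp (vars_bind₁ _ _ hi)
  have hii₁ : i = i₁ := by
    have h := vars_add_subset _ _ hi₁'
    rw [vars_C, Finset.union_empty, vars_X, Finset.mem_singleton] at h
    exact h
  subst hii₁
  obtain ⟨i₂, hi₂, hi₂'⟩ := Finset.mem_biUnion.mp (vars_bind₁ _ _ hi₁)
  by_cases h : i₂ = j
  · rw [if_pos h, ← C_1, vars_C] at hi₂'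
    exact absurd hi₂' (Finset.notMem_empty _)
  · rw [if_neg h, vars_X, Finset.mem_singleton] at hi₂'
    subst hi₂'
    exact Finset.mem_erase.mpr ⟨h, hi₂⟩

omit [Fintype σ] [DecidableEq σ] in
/-- A homogeneous component uses no new letter. [folklore] -/
theorem vars_homogeneousComponent_subset (n : ℕ) (P : MvPolynomial σ K) :
    (homogeneousComponent n P).vars ⊆ P.vars := by
  classical
  intro i hi
  obtain ⟨d, hd, hid⟩ := (mem_vars_iff_mem_support i).mp hi
  exact (mem_vars_iff_mem_support i).mpr ⟨d, mem_support_of_mem_support_homogeneousComponent hd, hid⟩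

omit [Fintype σ] [DecidableEq σ] in
/-- **A ONE-LETTER polynomial has a MONOMIAL initial form**: `vars Q ⊆ {k}` and `ord₀ Q = m` give
`in_m(Q) = c·u_k^m`, `c ≠ 0`. [folklore] -/
theorem homogeneousComponent_eq_monomial_of_vars_subset {Q : MvPolynomial σ K} {k : σ} (hQ : Q.vars ⊆ {k})
    {m : ℕ} (hm : ordZero Q = m) :
    homogeneousComponent m Q = monomial (Finsupp.single k m) (coeff (Finsupp.single k m) Q) ∧
      coeff (Finsupp.single k m) Q ≠ 0 := by
  classical
  have hsupp : ∀ d ∈ Q.support, d = Finsupp.single k (d k) := fun d hd =>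
    Finsupp.support_subset_singleton.mp fun i hi => hQ ((mem_vars_iff_mem_support i).mpr ⟨d, hd, hi⟩)
  have hcomp : homogeneousComponent m Q = monomial (Finsupp.single k m) (coeff (Finsupp.single k m) Q) := by
    ext e
    rw [coeff_homogeneousComponent, coeff_monomial]
    by_cases h : Finsupp.single k m = e
    · subst h; rw [if_pos (Finsupp.degree_single k m), if_pos rfl]
    · rw [if_neg h]
      split_ifs with hdeg
      · by_contra hne
        have he : e ∈ Q.support := mem_support_iff.mpr hne
        apply h
        have h1 := hsupp e he
        rw [h1, Finsupp.degree_single] at hdeg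
        rw [h1, hdeg]
      · rfl
  refine ⟨hcomp, fun h0 => homogeneousComponent_ne_zero_of_ordZero_eq hm ?_⟩
  rw [hcomp, h0, map_zero]

omit [Fintype σ] [DecidableEq σ] in
/-- **Initial form of (anything) × (order `m`) in degree `m`**: only the constant term of the first factor counts,
`in_m(U·P) = U(0)·in_m(P)` when `ord₀ P = m`. [folklore] -/
theorem homogeneousComponent_mul_of_ordZero_eq (U P : MvPolynomial σ K) {m : ℕ} (hm : ordZero P = m) :
    homogeneousComponent m (U * P) = C (constantCoeff U) * homogeneousComponent m P := by
  have hsplit : U * P = C (constantCoeff U) * P + (U - C (constantCoeff U)) * P := by ring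
  have hord : 1 ≤ ordZero (U - C (constantCoeff U)) := by
    rw [one_le_ordZero_iff, map_sub, constantCoeff_C, sub_self]
  have hvan : homogeneousComponent m ((U - C (constantCoeff U)) * P) = 0 := by
    apply homogeneousComponent_eq_zero_of_lt_ordZero
    rw [ordZero_mul, hm]
    calc (m : ℕ∞) < ((m + 1 : ℕ) : ℕ∞) := by exact_mod_cast Nat.lt_succ_self m
      _ = 1 + (m : ℕ∞) := by push_cast; ring
      _ ≤ ordZero (U - C (constantCoeff U)) + (m : ℕ∞) := add_le_add hord le_rfl
  rw [hsplit, map_add, hvan, add_zero, homogeneousComponent_C_mul]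

omit [Fintype σ] in
/-- `dehom_j (u_i) = u_i + b_i` for `i ≠ j`. [folklore] -/
theorem dehom_X_of_ne {i j : σ} (h : i ≠ j) (b : σ → K) : dehom j b (X i) = X i + C (b i) := by
  unfold dehom PointBlowup.translate
  rw [aeval_X, if_neg h, aeval_X]

end Algebra

section Walk

variable {K : Type} [Field K] [DecidableEq K]

variable {q : ℕ} {s₀ : State (Fin 3) K}

/-! ### §3d THE ON-PLANE LAW ALONG THE WALK: at a vertex-law move a tilted cone puts the direction on its plane -/

/-- **THE ON-PLANE LAW ALONG THE WALK.**  At a move where the vertex law holds (every stalled move,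
`vertexLawAt_of_stall`), let `g₀` be a `μ_P`-minimiser whose initial form is `r·u^s · H^γ` with `H = Σ cᵢuᵢ` linear,
`γ > 0`, such that `H^γ` carries no divisibility by a LOST young coordinate (`ord_{u_i} g₀ ≤ s_i` for young `i` with
`i = j ∨ b_i ≠ 0`; automatic when `H` has two non-zero coefficients).  Then THE DIRECTION OF THE MOVE LIES ON THE PLANE
`{H = 0}`: `Σ cᵢ δᵢ = 0` — the contact equation of `ContactLineFrom` at this move.  (Bookkeeping:
`a₀·lostMass ≤` the
lost content of `u^s`, so the vertex law leaves at least `kept content + γ` for `ord₀ dirForm`, and §1d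
applies.) [new] [folklore] -/
theorem eval_direction_eq_zero_of_vertexLawAt (W : ForcedWalk q s₀) (t : ℕ) (hV : VertexLawAt W t)
    {J₀ : Fin 3 →₀ ℕ} (hJ₀ : J₀ ∈ (ifp W t).idx)
    (hμ : (ifp W t).muP q = levelRatio (ordZero ((ifp W t).gen J₀)) (q - J₀.degree))
    (s : Fin 3 →₀ ℕ) {r : K} (hr : r ≠ 0) (c : Fin 3 → K) {γ : ℕ} (hγ : 0 < γ)
    (hd₀ : ordZero ((ifp W t).gen J₀) = ((s.degree + γ : ℕ) : ℕ∞))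
    (hG : homogeneousComponent (s.degree + γ) ((ifp W t).gen J₀) = monomial s r * (∑ i, C (c i) * X i) ^ γ)
    (hs : ∀ i ∈ (ifp W t).young, (i = W.j t ∨ W.b t i ≠ 0) → divisorOrder i ((ifp W t).gen J₀) ≤ ((s i : ℕ) : ℕ∞)) :
    ∑ i, c i * direction W t i = 0 := by
  classical
  set j := W.j t with hjdef
  set b := W.b t with hbdef
  set g₀ := (ifp W t).gen J₀ with hg₀
  set a₀ : ℕ := q - J₀.degree with ha₀
  have hg₀ne : g₀ ≠ 0 := by
    intro h0; rw [h0, ordZero_zero] at hd₀; exact ENat.top_ne_coe _ hd₀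
  have ha₀pos : 0 < a₀ := by have := (level_bounds W t J₀ hJ₀).2; omega
  have ha₀q : (0 : ℚ) < a₀ := by exact_mod_cast ha₀pos
  -- the vertex law at this move for this minimiser
  have hlaw := hV J₀ hJ₀ hμ (s.degree + γ) hd₀
  -- the direction form is non-zero, of order n
  set T := dirForm (s.degree + γ) j b g₀ with hT
  have hTne : T ≠ 0 := dirForm_ne_zero j b hd₀
  set n : ℕ := (ordZero T).toNat with hn
  have hTn : ordZero T = n := (coe_toNat_ordZero hTne).symm
  -- kept and lost contents of u^s
  have hsplit : s.degree = (∑ i ∈ univ.filter (fun i => i = j ∨ b i ≠ 0), s i) +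
      ∑ i ∈ univ.filter (fun i => ¬ (i = j ∨ b i ≠ 0)), s i := by
    rw [Finsupp.degree_eq_sum]
    exact (Finset.sum_filter_add_sum_filter_not univ (fun i => i = j ∨ b i ≠ 0) (fun i => s i)).symm
  -- a₀ · μ_{P,D_i} ≤ s_i for the lost young i
  have hui : ∀ i ∈ (ifp W t).young, (i = j ∨ b i ≠ 0) → (a₀ : ℚ) * (((ifp W t).muPD q i).untopD 0) ≤ s i := by
    intro i hi hPi
    have h1 : (ifp W t).muPD q i ≤ levelRatio (divisorOrder i g₀) (q - J₀.degree) := Finset.inf_le hJ₀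
    have h2 : (ifp W t).muPD q i ≤ ((((s i : ℕ) : ℚ) / a₀ : ℚ) : WithTop ℚ) := by
      refine le_trans h1 (le_trans (levelRatio_mono (hs i hi hPi) _) ?_)
      rw [levelRatio_natCast]
    have h3 := untopD_le_of_le_coe h2
    rw [le_div_iff₀ ha₀q] at h3
    linarith
  have hmass : (a₀ : ℚ) * lostMass q j b (ifp W t) ≤ ((∑ i ∈ univ.filter (fun i => i = j ∨ b i ≠ 0), s i : ℕ) : ℚ) := by
    unfold lostMass
    rw [Finset.mul_sum, Nat.cast_sum]
    calc ∑ i ∈ (ifp W t).young with (i = j ∨ b i ≠ 0), (a₀ : ℚ) * ((ifp W t).muPD q i).untopD 0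
        ≤ ∑ i ∈ (ifp W t).young with (i = j ∨ b i ≠ 0), ((s i : ℕ) : ℚ) :=
          Finset.sum_le_sum fun i hi => hui i (Finset.mem_filter.mp hi).1 (Finset.mem_filter.mp hi).2
      _ ≤ ∑ i ∈ univ.filter (fun i => i = j ∨ b i ≠ 0), ((s i : ℕ) : ℚ) := by
          refine Finset.sum_le_sum_of_subset_of_nonneg (fun i hi => ?_) (fun i _ _ => by positivity)
          exact Finset.mem_filter.mpr ⟨Finset.mem_univ _, (Finset.mem_filter.mp hi).2⟩
  -- hence kept + γ ≤ n
  have hkn : (∑ i ∈ univ.filter (fun i => ¬ (i = j ∨ b i ≠ 0)), s i) + γ ≤ n := by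
    have h1 : ((s.degree + γ : ℕ) : ℚ) - (a₀ : ℚ) * lostMass q j b (ifp W t) ≤ (n : ℚ) := hlaw
    have h2 : (((∑ i ∈ univ.filter (fun i => ¬ (i = j ∨ b i ≠ 0)), s i) + γ : ℕ) : ℚ) ≤ (n : ℚ) := by
      rw [hsplit] at h1; push_cast at h1 hmass ⊢; linarith
    exact_mod_cast h2
  -- the algebraic on-plane law with cofactor M = r·u^s
  have hM : dehom j b (monomial s r) ≠ 0 := by
    intro h0
    have := ordZero_dehom_monomial j b s hr
    rw [h0, ordZero_zero] at this
    exact ENat.top_ne_coe _ this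
  refine eval_direction_eq_zero_of_le_ordZero_dirForm j b c hγ hG hM ?_
  rw [ordZero_dehom_monomial j b s hr, ← hT, hTn, ← Nat.cast_add, Nat.cast_le]
  exact hkn

/-! ### §3e THE OLD-LETTER LAW: a cone `r·u^s·(c₀u_m)^γ` with `m` OLD forces the letter `m` to be respected forever -/

omit [DecidableEq K] in
/-- `c₀·u_m` as a linear form `Σ cᵢuᵢ` with `c = c₀·e_m`. [folklore] -/
theorem sum_C_single_mul_X (m : Fin 3) (c₀ : K) :
    (∑ i, C ((Pi.single m c₀ : Fin 3 → K) i) * X i : MvPolynomial (Fin 3) K) = C c₀ * X m := by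
  rw [Finset.sum_eq_single m]
  · rw [Pi.single_eq_same]
  · intro k _ hk; rw [Pi.single_eq_of_ne hk, C_0, zero_mul]
  · intro h; exact absurd (Finset.mem_univ _) h

omit [DecidableEq K] in
/-- The cone `r·u^s·(c₀u_m)^γ` is the monomial `(r c₀^γ)·u^{s + γ e_m}`. [folklore] -/
theorem monomial_mul_C_mul_X_pow (s : Fin 3 →₀ ℕ) (r c₀ : K) (m : Fin 3) (γ : ℕ) :
    (monomial s r * (C c₀ * X m) ^ γ : MvPolynomial (Fin 3) K) = monomial (s + Finsupp.single m γ) (r * c₀ ^ γ) := by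
  rw [mul_pow, ← map_pow, X_pow_eq_monomial, C_mul_monomial, mul_one, monomial_mul]

/-- **THE OLD-LETTER STEP.**  At a stalled move `t` of a root walk that is clean for the minimisers, let `J₀` be a
`μ_P`-minimiser whose initial form is `r·u^s·(c₀ u_m)^γ` with `γ > 0` and the letter `m` OLD (`m ∉ young`).  Then
(i) THE MOVE RESPECTS `m`: `W.j t ≠ m ∧ W.b t m = 0` (the on-plane law: the direction lies on `{u_m = 0}`), and
(ii) at `t + 1`, `J₀` is again a minimiser (stall rigidity) whose initial form is `r'·u^{s'}·(c₀ u_m)^γ` with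
`m` STILL OLD
(the carry law: the line `u_m` is carried unchanged since the chart is not `m`).  [new] [folklore] -/
theorem oldLetter_step {p e : ℕ} (hp : p.Prime) [CharP K p] {s₀ : State (Fin 3) K} (hs : IsRoot (p ^ e) s₀)
    (W : ForcedWalk (p ^ e) s₀) (t : ℕ)
    (hst : (ifp W (t + 1)).muTilde (p ^ e) = (ifp W t).muTilde (p ^ e)) (hcl : CleanAt W t)
    {J₀ : Fin 3 →₀ ℕ} (hJ₀ : J₀ ∈ (ifp W t).idx)
    (hμ : (ifp W t).muP (p ^ e) = levelRatio (ordZero ((ifp W t).gen J₀)) (p ^ e - J₀.degree))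
    {m : Fin 3} (hm : m ∉ (ifp W t).young) (s : Fin 3 →₀ ℕ) {r c₀ : K} (hr : r ≠ 0) (hc₀ : c₀ ≠ 0)
    {γ : ℕ} (hγ : 0 < γ) (hd₀ : ordZero ((ifp W t).gen J₀) = ((s.degree + γ : ℕ) : ℕ∞))
    (hG : homogeneousComponent (s.degree + γ) ((ifp W t).gen J₀) = monomial s r * (C c₀ * X m) ^ γ) :
    (W.j t ≠ m ∧ W.b t m = 0) ∧
    (J₀ ∈ (ifp W (t + 1)).idx ∧
      (ifp W (t + 1)).muP (p ^ e) = levelRatio (ordZero ((ifp W (t + 1)).gen J₀)) (p ^ e - J₀.degree) ∧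
      m ∉ (ifp W (t + 1)).young ∧
      ∃ (s' : Fin 3 →₀ ℕ) (r' : K), r' ≠ 0 ∧
        ordZero ((ifp W (t + 1)).gen J₀) = ((s'.degree + γ : ℕ) : ℕ∞) ∧
        homogeneousComponent (s'.degree + γ) ((ifp W (t + 1)).gen J₀) = monomial s' r' * (C c₀ * X m) ^ γ) := by
  classical
  have hG' : homogeneousComponent (s.degree + γ) ((ifp W t).gen J₀) =
      monomial s r * (∑ i, C ((Pi.single m c₀ : Fin 3 → K) i) * X i) ^ γ := by rw [sum_C_single_mul_X]; exact hG
  have hgne : (ifp W t).gen J₀ ≠ 0 := by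
    intro h0; rw [h0, ordZero_zero] at hd₀; exact ENat.top_ne_coe _ hd₀
  -- the support monomial `s + γ e_m` of the cone bounds the divisor orders of every other letter
  have hsupp : s + Finsupp.single m γ ∈ ((ifp W t).gen J₀).support := by
    refine mem_support_of_mem_support_homogeneousComponent (d := s.degree + γ) ?_
    rw [hG, monomial_mul_C_mul_X_pow, support_monomial, if_neg (mul_ne_zero hr (pow_ne_zero _ hc₀))]
    exact Finset.mem_singleton_self _
  have hdiv : ∀ i ∈ (ifp W t).young, (i = W.j t ∨ W.b t i ≠ 0) →
      divisorOrder i ((ifp W t).gen J₀) ≤ ((s i : ℕ) : ℕ∞) := by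
    intro i hi _
    have him : i ≠ m := fun h => hm (h ▸ hi)
    have h1 := divisorOrder_le_exponent (i := i) hsupp
    rwa [Finsupp.add_apply, Finsupp.single_eq_of_ne him, add_zero] at h1
  -- (i) the on-plane law: the direction lies on `{u_m = 0}`
  have hV : VertexLawAt W t := vertexLawAt_of_stall hp hs W t hst.symm.le
  have hon := eval_direction_eq_zero_of_vertexLawAt W t hV hJ₀ hμ s hr (Pi.single m c₀) hγ hd₀ hG' hdiv
  have hon' : c₀ * direction W t m = 0 := by
    rw [Finset.sum_eq_single m (fun k _ hk => by rw [Pi.single_eq_of_ne hk, zero_mul])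
      (fun h => absurd (Finset.mem_univ _) h), Pi.single_eq_same] at hon
    exact hon
  have hdm : direction W t m = 0 := (mul_eq_zero.mp hon').resolve_left hc₀
  have hjm : W.j t ≠ m := by
    intro h; rw [← h, direction_chart] at hdm; exact one_ne_zero hdm
  have hbm : W.b t m = 0 := by rwa [direction_of_ne W t (Ne.symm hjm)] at hdm
  refine ⟨⟨hjm, hbm⟩, ?_⟩
  -- (ii) carry + stall rigidity
  have hlev := level_bounds W t J₀ hJ₀
  have ha : p ^ e - J₀.degree ≤ s.degree + γ := by
    have := sing_ifp hp hs W t J₀ hJ₀ hgne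
    rw [hd₀] at this; exact_mod_cast this
  have honb : ∑ i, (Pi.single m c₀ : Fin 3 → K) i * Function.update (W.b t) (W.j t) 1 i = 0 := hon
  have hupd : Function.update (Pi.single m c₀ : Fin 3 → K) (W.j t) 0 = Pi.single m c₀ := by
    funext i
    by_cases hij : i = W.j t
    · rw [hij, Function.update_self, Pi.single_eq_of_ne hjm]
    · rw [Function.update_of_ne hij]
  have hcb : ∃ i, Function.update (Pi.single m c₀ : Fin 3 → K) (W.j t) 0 i ≠ 0 :=
    ⟨m, by rw [hupd, Pi.single_eq_same]; exact hc₀⟩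
  have hcarry := carry_of_clean (W.b t) (W.onExc t) ha hd₀ s hr (Pi.single m c₀) γ hG' honb hcb
    (hcl J₀ hJ₀ hμ _ hd₀)
  rw [hupd, sum_C_single_mul_X] at hcarry
  have hgen : (ifp W (t + 1)).gen J₀ =
      PointBlowup.translate (W.b t) (chartTransform (p ^ e - J₀.degree) (W.j t) ((ifp W t).gen J₀)) := by
    rw [ifp_succ]; rfl
  have hrig := stall_rigid (p ^ e) (W.j t) (W.b t) (W.onExc t) (ifp W t) (fun J hJ => (level_bounds W t J hJ).2)
    (sing_ifp hp hs W t) (by rw [← ifp_succ]; exact hst.symm.le) hJ₀ hμ hd₀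
  refine ⟨by rw [idx_ifp] at hJ₀ ⊢; exact hJ₀, by rw [ifp_succ]; exact hrig.2.2.1, ?_, ?_⟩
  · rw [ifp_succ]
    show m ∉ insert (W.j t) ((ifp W t).young.filter fun i => W.b t i = 0)
    rw [Finset.mem_insert, Finset.mem_filter, not_or]
    exact ⟨Ne.symm hjm, fun h => hm h.1⟩
  · refine ⟨Finsupp.single (W.j t) (s.degree + γ - (p ^ e - J₀.degree)) +
        (s.erase (W.j t)).filter (fun i => W.b t i = 0),
      r * ∏ i ∈ univ.filter (fun i => W.b t i ≠ 0), W.b t i ^ ((s.erase (W.j t)) i),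
      mul_ne_zero hr (Finset.prod_ne_zero_iff.mpr fun i hi => pow_ne_zero _ (Finset.mem_filter.mp hi).2), ?_, ?_⟩
    · rw [hgen, hcarry.1, map_add, Finsupp.degree_single]
      push_cast; ring
    · have hdeg : (Finsupp.single (W.j t) (s.degree + γ - (p ^ e - J₀.degree)) +
          (s.erase (W.j t)).filter (fun i => W.b t i = 0)).degree + γ =
          s.degree + γ - (p ^ e - J₀.degree) + (((s.erase (W.j t)).filter (fun i => W.b t i = 0)).degree + γ) := by
        rw [map_add, Finsupp.degree_single]; ring
      rw [hdeg, hgen, hcarry.2]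

/-- **THE OLD-LETTER LAW (induction).**  On a stalled stretch that is clean for the minimisers from time `t₀` on, an
old letter `u_m` in line position in a minimiser's cone at `t₀` is RESPECTED FOREVER: `W.j t ≠ m ∧ W.b t m = 0` for all
`t ≥ t₀` — g19's PLANAR letter.  [new] [folklore] -/
theorem planar_of_oldLetter {p e : ℕ} (hp : p.Prime) [CharP K p] {s₀ : State (Fin 3) K} (hs : IsRoot (p ^ e) s₀)
    (W : ForcedWalk (p ^ e) s₀) (t₀ : ℕ)
    (hst : ∀ t, t₀ ≤ t → (ifp W (t + 1)).muTilde (p ^ e) = (ifp W t).muTilde (p ^ e))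
    (hcl : ∀ t, t₀ ≤ t → CleanAt W t)
    {J₀ : Fin 3 →₀ ℕ} (hJ₀ : J₀ ∈ (ifp W t₀).idx)
    (hμ : (ifp W t₀).muP (p ^ e) = levelRatio (ordZero ((ifp W t₀).gen J₀)) (p ^ e - J₀.degree))
    {m : Fin 3} (hm : m ∉ (ifp W t₀).young) (s : Fin 3 →₀ ℕ) {r c₀ : K} (hr : r ≠ 0) (hc₀ : c₀ ≠ 0)
    {γ : ℕ} (hγ : 0 < γ) (hd₀ : ordZero ((ifp W t₀).gen J₀) = ((s.degree + γ : ℕ) : ℕ∞))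
    (hG : homogeneousComponent (s.degree + γ) ((ifp W t₀).gen J₀) = monomial s r * (C c₀ * X m) ^ γ) :
    ∀ t, t₀ ≤ t → W.j t ≠ m ∧ W.b t m = 0 := by
  -- invariant at time t₀ + n
  have key : ∀ n : ℕ, (J₀ ∈ (ifp W (t₀ + n)).idx ∧
      (ifp W (t₀ + n)).muP (p ^ e) = levelRatio (ordZero ((ifp W (t₀ + n)).gen J₀)) (p ^ e - J₀.degree) ∧
      m ∉ (ifp W (t₀ + n)).young ∧
      ∃ (s' : Fin 3 →₀ ℕ) (r' : K), r' ≠ 0 ∧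
        ordZero ((ifp W (t₀ + n)).gen J₀) = ((s'.degree + γ : ℕ) : ℕ∞) ∧
        homogeneousComponent (s'.degree + γ) ((ifp W (t₀ + n)).gen J₀) = monomial s' r' * (C c₀ * X m) ^ γ) ∧
      (W.j (t₀ + n) ≠ m ∧ W.b (t₀ + n) m = 0) := by
    intro n
    induction n with
    | zero =>
      have h := oldLetter_step hp hs W t₀ (hst t₀ le_rfl) (hcl t₀ le_rfl) hJ₀ hμ hm s hr hc₀ hγ hd₀ hG
      exact ⟨⟨hJ₀, hμ, hm, s, r, hr, hd₀, hG⟩, h.1⟩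
    | succ n ih =>
      obtain ⟨⟨hJ, hμ', hm', s', r', hr', hd', hG'⟩, _⟩ := ih
      have h := oldLetter_step hp hs W (t₀ + n) (hst _ (Nat.le_add_right _ _)) (hcl _ (Nat.le_add_right _ _))
        hJ hμ' hm' s' hr' hc₀ hγ hd' hG'
      obtain ⟨hJ'', hμ'', hm'', s'', r'', hr'', hd'', hG''⟩ := h.2
      have h2 := oldLetter_step hp hs W (t₀ + n + 1) (hst _ (by omega)) (hcl _ (by omega))
        hJ'' hμ'' hm'' s'' hr'' hc₀ hγ hd'' hG''
      exact ⟨⟨hJ'', hμ'', hm'', s'', r'', hr'', hd'', hG''⟩, h2.1⟩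
  intro t ht
  obtain ⟨n, rfl⟩ := Nat.exists_eq_add_of_le ht
  exact (key n).2

end Walk

end Summit.ResolutionOfSingularities.ResolutionOfSingularities.Theorems.StallVertex
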